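/-
Copyright: the b2b-balaban cell (near-miss cell 7), T⁴-continuum fan-out, lineage t4-ne7b-p2 (node U5c RENEWAL member).
Released under the licence of the surrounding project.
-/
import Summits.QuantumFields.BalabanUV.T4Continuum.Support.RenewalRecords
import Summits.QuantumFields.BalabanUV.T4Continuum.Support.HistoryAdmissible

/-!
# The spine projection: print's physical genealogies (`PGen`) ↦ the renewal route's spine records (leaf N1c, kernel half)

Summits-side support leaf of the T⁴-continuum cell (rung (B)+1 on a FINITE torus only; NOT infinite volume, NOT the
mass gap, NOT the Clay statement; NOT a proof of the spine estimate NE7b).  Lineage `t4-ne7b-p2` (generation 23),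
node U5c, RENEWAL route; the KERNEL half of leaf N1c of the ROUND-2 skeleton `t4/skeletons/NE7b-t4-ne7b-p2.md` v1.7:
ONE transcription of B16's histories for both NE7b roads — the COUNT road's `HistoryAdmissible.PGen` (S1, p207789) is
projected to the renewal road's `RenewalRecords.Rec` along the ORIENTATION «the older partner continues, the younger is
absorbed» (ties towards print's endpoint `X`, exactly as `PGen.rootCell` ∕ `Gen.root`).  [folklore] finite
combinatorics over the two roads' OWN carriers; nothing is quoted from print, nothing printed is asserted, no `[cite:]`
tag; none of the cell's conditionals ((B), BetaPertH) occurs.  The READING half of N1c (these genealogies ARE the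
histories of the terms of (1.104)) is the displayed hypothesis H3 of both roads and is NOT minted here; `PGen.Alive`
below is a PREDICATE on the COUNT road's carrier, not a fact.

WHAT.  §1 the physical labels `PLabel γ` of spine records (root birth `(j, d′, z)`, renewal at `u`, join at `t`, and the
DUMMY of an absorbed partner carrying the partner's genealogy `Y` and its REMAINING LIFE `ρ`) with the window table
`pW R n₁` (`= dictW` on births ∕ renewals ∕ joins, `= ρ` on dummies — amendment N5⁺); §2 `addMove` (one more move at
step `u`: appended to the newest block if `u` is its step, else a new edge) with `tree_addMove` (the tree becomes
`m.apply u tree`), `last_addMove`, `valid_addMove`; §3 **`spine R n₁ : PGen γ → Rec (PLabel γ)`** and the three facts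
the renewal forest asks of a pending record (`RenewalRecordsEnd.sum_weight_tilted_le`): **`reach_spine`** — the spine
tree's reach IS the canonical label's reach `P.toGen.reach (dictW R n₁)` (so `hpend` is the COUNT road's S1b
`HistoryRealise.lt_reach_of_pendingAt` BY NAME) —, **`valid_spine`** — `Rec.Valid` from print's timing discipline
`PGen.Adm` and booked aliveness `Alive` (renewal while booked alive `h < reach`, join while both booked alive
`t ≤ reach`; implied by the COUNT road's `RenewAtReach ∧ JoinInLife` — `alive_of_renewAtReach` —, and for REALISED
histories by S1b's `renew_lt_reach` ∕ `joinInLife_of_realises` with no `RenewAtReach`) —, **`last_spine`**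
(`rootStep + last = lastStep`, hence `last ≤ K − rootStep` under `Adm K`).  §4 decided sanity on
`HistoryAdmissible.PGen.Sanity.hist`.

HONEST DEPENDENCY (cell): continuum YM on T⁴ ⇐ BetaPertH ∧ nine spine estimates (0/9 proved); BetaPertH ⇐ (D1) ∧ (D4)
∧ CAP+tail.  This file changes none of it.
-/

open Finset
open Literature.MathematicalPhysics.QuantumFieldTheory.Balaban1983to89
open T4PersistenceDictionary T4PersistenceRenewal T4PersistenceGrove
open Summit.QuantumFields.BalabanUV.T4Continuum.HistoryAdmissible
open Summit.QuantumFields.BalabanUV.T4Continuum.RenewalRecords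

namespace Summit.QuantumFields.BalabanUV.T4Continuum.RenewalSpine

/-! ## §1 Physical labels and their windows -/

/-- **PHYSICAL LABELS** of the renewal road's spine records: `root j d′ z` — the birth of the oldest constituent
(step `j`, class `d′`, anchor `z`); `ren u` — a renewal appearing at step `u`; `join t` — a join at step `t` (carries
the surplus); `dummy Y ρ` — an ABSORBED PARTNER: its physical genealogy `Y` and its remaining booked life `ρ` beyond
the join (amendment N5⁺: the dummy's window). [folklore] -/
inductive PLabel (γ : Type*) : Type _
  | root (j cls : ℕ) (cell : γ) : PLabel γ
  | ren (u : ℕ) : PLabel γ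
  | join (t : ℕ) : PLabel γ
  | dummy (Y : PGen γ) (ρ : ℕ) : PLabel γ
  deriving DecidableEq

/-- **THE WINDOW TABLE** on physical labels: the dictionary's `dictW R n₁` on births ∕ renewals ∕ joins, and the
partner's remaining life on a dummy. [folklore] -/
def pW {γ : Type*} (R : ℕ → ℕ) (n₁ : ℕ) : PLabel γ → ℕ
  | PLabel.root j cls _ => dictW R n₁ (j, 0, cls)
  | PLabel.ren u => dictW R n₁ (u, 1, 0)
  | PLabel.join t => dictW R n₁ (t, 2, 0)
  | PLabel.dummy _ ρ => ρ

/-! ## §2 Adding one move to a record -/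

section AddMove

variable {ε : Type*}

/-- applying a concatenated block [folklore] -/
theorem applyBlock_append (b b' : List (Move ε)) (u : ℕ) (T : Gen ε) :
    applyBlock (b ++ b') u T = applyBlock b' u (applyBlock b u T) := by
  induction b generalizing T with
  | nil => rfl
  | cons m b ih => exact ih _

/-- validity of a concatenated block [folklore] -/
theorem blockValid_append (W : ε → ℕ) (b b' : List (Move ε)) (u : ℕ) (T : Gen ε) :
    BlockValid W (b ++ b') u T ↔ BlockValid W b u T ∧ BlockValid W b' u (applyBlock b u T) := by
  induction b generalizing T with
  | nil => simp [BlockValid, applyBlock]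
  | cons m b ih => simp [BlockValid, applyBlock, ih, and_assoc]

/-- **ONE MORE MOVE** `m` at absolute step `u` on a record at birth step `j`: appended to the newest block when `u`
is that block's step (`u ≤ j + last`, used only with equality), else a NEW EDGE with gap `u − (j + last) − 1`.
[folklore] -/
def addMove (j : ℕ) (r : Rec ε) (m : Move ε) (u : ℕ) : Rec ε :=
  if u ≤ j + r.last then
    match r.hist with
    | [] => ⟨r.root, r.tail ++ [m], []⟩
    | e :: es => ⟨r.root, r.tail, ⟨e.gap, e.first, e.rest ++ [m]⟩ :: es⟩
  else ⟨r.root, r.tail, ⟨u - (j + r.last) - 1, m, []⟩ :: r.hist⟩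

/-- the root label is unchanged [folklore] -/
theorem root_addMove (j : ℕ) (r : Rec ε) (m : Move ε) (u : ℕ) : (addMove j r m u).root = r.root := by
  unfold addMove; split
  · cases h : r.hist <;> simp
  · rfl

/-- the end age after one more move at step `u ≥ j + last` is `u − j` [folklore] -/
theorem last_addMove (j : ℕ) (r : Rec ε) (m : Move ε) {u : ℕ} (hu : j + r.last ≤ u) :
    j + (addMove j r m u).last = u := by
  unfold addMove
  split
  · rename_i h
    have hu' : u = j + r.last := le_antisymm h hu
    cases hh : r.hist with
    | nil => simp only [Rec.last, endAge, hh] at hu' ⊢; omega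
    | cons e es =>
        simp only [Rec.last, hh, endAge] at hu' ⊢
        omega
  · rename_i h
    simp only [Rec.last, endAge] at hu h ⊢
    omega

/-- **THE TREE AFTER ONE MORE MOVE** at step `u ≥ j + last` is `m.apply u tree`. [folklore] -/
theorem tree_addMove (j : ℕ) (r : Rec ε) (m : Move ε) {u : ℕ} (hu : j + r.last ≤ u) :
    (addMove j r m u).tree j = m.apply u (r.tree j) := by
  unfold addMove
  split
  · rename_i h
    have hu' : u = j + r.last := le_antisymm h hu
    cases hh : r.hist with
    | nil =>
        simp only [Rec.last, hh, endAge, Nat.add_zero] at hu'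
        subst hu'
        simp [Rec.tree, treeOf, rootTree, hh, applyBlock_append, applyBlock]
    | cons e es =>
        simp only [Rec.last, hh] at hu'
        subst hu'
        simp [Rec.tree, treeOf, hh, Edge.block, endAge, applyBlock_append, applyBlock]
  · rename_i h
    have hgap : endAge r.hist + (u - (j + r.last) - 1) + 1 = u - j := by
      simp only [Rec.last] at hu h ⊢; omega
    simp only [Rec.tree, treeOf, Edge.block, endAge, applyBlock]
    rw [hgap, show j + (u - j) = u by omega]

/-- **VALIDITY AFTER ONE MORE MOVE**: a valid record stays valid when the new move is valid on its tree
(`u ≥ j + last`). [folklore] -/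
theorem valid_addMove (W : ε → ℕ) (j : ℕ) {r : Rec ε} (hr : r.Valid W j) (m : Move ε) {u : ℕ} (hu : j + r.last ≤ u)
    (hm : m.Valid W u (r.tree j)) : (addMove j r m u).Valid W j := by
  unfold addMove
  split
  · rename_i h
    have hu' : u = j + r.last := le_antisymm h hu
    cases hh : r.hist with
    | nil =>
        simp only [Rec.last, hh, endAge, Nat.add_zero] at hu'
        subst hu'
        refine ⟨?_, trivial⟩
        rw [blockValid_append]
        refine ⟨hr.1, ?_, trivial⟩
        simpa [Rec.tree, treeOf, rootTree, hh] using hm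
    | cons e es =>
        simp only [Rec.last, hh] at hu'
        subst hu'
        have h2 := hr.2
        rw [hh] at h2
        refine ⟨hr.1, h2.1, ?_⟩
        show BlockValid W (e.first :: (e.rest ++ [m])) (j + endAge (⟨e.gap, e.first, e.rest ++ [m]⟩ :: es))
          (treeOf j (rootTree j r.root r.tail) es)
        rw [← List.cons_append, blockValid_append]
        refine ⟨h2.2, ?_, trivial⟩
        simpa [Rec.tree, treeOf, hh, Edge.block, endAge] using hm
  · rename_i h
    have hgap : endAge r.hist + (u - (j + r.last) - 1) + 1 = u - j := by
      simp only [Rec.last] at hu h ⊢; omega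
    refine ⟨hr.1, hr.2, ?_⟩
    show BlockValid W [m] (j + (endAge r.hist + (u - (j + r.last) - 1) + 1)) (treeOf j (rootTree j r.root r.tail) r.hist)
    rw [hgap, show j + (u - j) = u by omega]
    exact ⟨hm, trivial⟩

end AddMove

/-! ## §3 The spine of a physical genealogy, its reach, its validity, its age -/

section Spine

variable {γ : Type*}

/-- **BOOKED ALIVENESS** of a physical genealogy (predicate on the COUNT road's carrier): every renewal happens while
the renewed line is booked alive (`h < reach`), every join while both partners are (`t ≤ reach`). [folklore] -/
def _root_.Summit.QuantumFields.BalabanUV.T4Continuum.HistoryAdmissible.PGen.Alive (W : PEv → ℕ) : PGen γ → Prop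
  | PGen.birth _ _ _ => True
  | PGen.renew G h => G.Alive W ∧ h < G.toGen.reach W
  | PGen.join X Y t => X.Alive W ∧ Y.Alive W ∧ t ≤ X.toGen.reach W ∧ t ≤ Y.toGen.reach W

/-- the COUNT road's certified sub-class is booked alive: `RenewAtReach ∧ JoinInLife ⇒ Alive` [folklore] -/
theorem alive_of_renewAtReach (W : PEv → ℕ) :
    ∀ {P : PGen γ}, P.RenewAtReach W → P.JoinInLife W → P.Alive W
  | PGen.birth _ _ _, _, _ => trivial
  | PGen.renew G h, hR, hJ => by
      simp only [PGen.RenewAtReach] at hR; simp only [PGen.JoinInLife] at hJ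
      exact ⟨alive_of_renewAtReach W hR.1 hJ, by rw [← hR.2]; exact Nat.lt_succ_self h⟩
  | PGen.join X Y t, hR, hJ => by
      simp only [PGen.RenewAtReach] at hR; simp only [PGen.JoinInLife] at hJ
      exact ⟨alive_of_renewAtReach W hR.1 hJ.1, alive_of_renewAtReach W hR.2 hJ.2.1, hJ.2.2.1.le, hJ.2.2.2.le⟩

/-- **THE SPINE RECORD** of a physical genealogy (windows of the run `R`, merger allowance `n₁`): a birth is a bare
root; a renewal at `h + 1` adds the move `renew (ren (h+1))`; a join at `t` adds, to the OLDER partner's spine (ties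
towards `X`), the move `absorb (dummy Y ρ) (join t)` with `ρ = reach Y − t` the younger partner's remaining life.
[folklore] -/
def spine (R : ℕ → ℕ) (n₁ : ℕ) : PGen γ → Rec (PLabel γ)
  | PGen.birth j d z => ⟨PLabel.root j d z, [], []⟩
  | PGen.renew G h => addMove G.rootStep (spine R n₁ G) (Move.renew (PLabel.ren (h + 1))) (h + 1)
  | PGen.join X Y t =>
      if X.rootStep ≤ Y.rootStep then
        addMove X.rootStep (spine R n₁ X)
          (Move.absorb (PLabel.dummy Y (Y.toGen.reach (dictW R n₁) - t)) (PLabel.join t)) t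
      else
        addMove Y.rootStep (spine R n₁ Y)
          (Move.absorb (PLabel.dummy X (X.toGen.reach (dictW R n₁) - t)) (PLabel.join t)) t

/-- the root step of a join is the older partner's [folklore] -/
theorem rootStep_join_of_le {X Y : PGen γ} (t : ℕ) (h : X.rootStep ≤ Y.rootStep) :
    (PGen.join X Y t).rootStep = X.rootStep := by
  simp [PGen.rootStep, h]

/-- … and symmetrically [folklore] -/
theorem rootStep_join_of_not_le {X Y : PGen γ} (t : ℕ) (h : ¬ X.rootStep ≤ Y.rootStep) :
    (PGen.join X Y t).rootStep = Y.rootStep := by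
  simp [PGen.rootStep]; omega

/-- **THE AGE OF THE SPINE**: `rootStep + last (spine P) = lastStep P` under print's timing discipline. [folklore] -/
theorem last_spine (R : ℕ → ℕ) (n₁ : ℕ) {K : ℕ} : ∀ {P : PGen γ}, P.Adm K → P.rootStep + (spine R n₁ P).last = P.lastStep
  | PGen.birth j d z, _ => by simp [spine, Rec.last, endAge, PGen.rootStep, PGen.lastStep]
  | PGen.renew G h, hA => by
      have ih := last_spine R n₁ hA.1
      have h2 := hA.2.1
      simp only [spine, PGen.rootStep, PGen.lastStep]
      exact last_addMove _ _ _ (by omega)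
  | PGen.join X Y t, hA => by
      have ihX := last_spine R n₁ hA.1
      have ihY := last_spine R n₁ hA.2.1
      obtain ⟨-, -, hX, hY, -⟩ := hA
      simp only [spine, PGen.lastStep]
      split
      · rename_i h
        rw [rootStep_join_of_le t h]
        exact last_addMove _ _ _ (by omega)
      · rename_i h
        rw [rootStep_join_of_not_le t h]
        exact last_addMove _ _ _ (by omega)

/-- … hence the spine's events are over by the cutoff: `last ≤ K − rootStep` under `Adm K` [folklore] -/
theorem last_spine_le (R : ℕ → ℕ) (n₁ : ℕ) {K : ℕ} {P : PGen γ} (hA : P.Adm K) :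
    (spine R n₁ P).last ≤ K - P.rootStep := by
  have h := last_spine R n₁ hA
  have h' := hA.lastStep_le
  omega

/-- **THE REACH OF THE SPINE TREE IS THE CANONICAL LABEL'S REACH**: under `Adm` (events in order) and `Alive` (the
younger partner is booked alive at the join, so `t + (reach Y − t) = reach Y`),
`((spine P).tree rootStep).reach (pW R n₁) = P.toGen.reach (dictW R n₁)`. [folklore] -/
theorem reach_spine (R : ℕ → ℕ) (n₁ : ℕ) {K : ℕ} :
    ∀ {P : PGen γ}, P.Adm K → P.Alive (dictW R n₁) →
      ((spine R n₁ P).tree P.rootStep).reach (pW R n₁) = P.toGen.reach (dictW R n₁)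
  | PGen.birth j d z, _, _ => by
      simp [spine, Rec.tree, treeOf, rootTree, applyBlock, PGen.rootStep, PGen.toGen, pW]
  | PGen.renew G h, hA, hL => by
      have hlast := last_spine R n₁ hA.1
      have h2 := hA.2.1
      simp only [spine, PGen.rootStep, PGen.toGen, Gen.reach_renew]
      rw [tree_addMove _ _ _ (by omega), Move.reach_apply_renew _ _ (Nat.succ_pos h)]
      simp [pW]
  | PGen.join X Y t, hA, hL => by
      have ihX := reach_spine R n₁ hA.1 hL.1
      have ihY := reach_spine R n₁ hA.2.1 hL.2.1
      have hlX := last_spine R n₁ hA.1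
      have hlY := last_spine R n₁ hA.2.1
      obtain ⟨-, -, hX, hY, -⟩ := hA
      obtain ⟨-, -, haX, haY⟩ := hL
      simp only [spine, PGen.toGen, Gen.reach_merge]
      split
      · rename_i h
        rw [rootStep_join_of_le t h, tree_addMove _ _ _ (by omega), Move.reach_apply_absorb, ihX]
        simp only [pW]
        rw [show t + (Y.toGen.reach (dictW R n₁) - t) = Y.toGen.reach (dictW R n₁) by omega]
      · rename_i h
        rw [rootStep_join_of_not_le t h, tree_addMove _ _ _ (by omega), Move.reach_apply_absorb, ihY]
        simp only [pW]
        rw [show t + (X.toGen.reach (dictW R n₁) - t) = X.toGen.reach (dictW R n₁) by omega, max_comm]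

/-- **THE SPINE RECORD IS VALID** under `Adm` and `Alive`: every move happens while the spine tree is booked alive.
[folklore] -/
theorem valid_spine (R : ℕ → ℕ) (n₁ : ℕ) {K : ℕ} :
    ∀ {P : PGen γ}, P.Adm K → P.Alive (dictW R n₁) → (spine R n₁ P).Valid (pW R n₁) P.rootStep
  | PGen.birth j d z, _, _ => ⟨trivial, trivial⟩
  | PGen.renew G h, hA, hL => by
      have ih := valid_spine R n₁ hA.1 hL.1
      have hreach := reach_spine R n₁ hA.1 hL.1
      have hlast := last_spine R n₁ hA.1
      have h2 := hA.2.1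
      simp only [spine, PGen.rootStep]
      refine valid_addMove _ _ ih _ (by omega) ?_
      show 1 ≤ h + 1 ∧ h + 1 ≤ ((spine R n₁ G).tree G.rootStep).reach (pW R n₁)
      rw [hreach]
      exact ⟨Nat.succ_pos h, hL.2⟩
  | PGen.join X Y t, hA, hL => by
      have ihX := valid_spine R n₁ hA.1 hL.1
      have ihY := valid_spine R n₁ hA.2.1 hL.2.1
      have hrX := reach_spine R n₁ hA.1 hL.1
      have hrY := reach_spine R n₁ hA.2.1 hL.2.1
      have hlX := last_spine R n₁ hA.1
      have hlY := last_spine R n₁ hA.2.1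
      obtain ⟨-, -, hX, hY, -⟩ := hA
      obtain ⟨-, -, haX, haY⟩ := hL
      simp only [spine]
      split
      · rename_i h
        rw [rootStep_join_of_le t h]
        refine valid_addMove _ _ ihX _ (by omega) ?_
        show t ≤ ((spine R n₁ X).tree X.rootStep).reach (pW R n₁)
        rw [hrX]; exact haX
      · rename_i h
        rw [rootStep_join_of_not_le t h]
        refine valid_addMove _ _ ihY _ (by omega) ?_
        show t ≤ ((spine R n₁ Y).tree Y.rootStep).reach (pW R n₁)
        rw [hrY]; exact haY

/-- **`hpend` FOR THE SPINE**: a genealogy booked pending at the cutoff (`K < toGen.reach`, the COUNT road's S1b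
`HistoryRealise.lt_reach_of_pendingAt` for realised histories) has its spine tree reaching beyond `rootStep + (K −
rootStep)`. [folklore] -/
theorem pend_spine (R : ℕ → ℕ) (n₁ : ℕ) {K : ℕ} {P : PGen γ} (hA : P.Adm K) (hL : P.Alive (dictW R n₁))
    (hK : K < P.toGen.reach (dictW R n₁)) :
    P.rootStep + (K - P.rootStep) < ((spine R n₁ P).tree P.rootStep).reach (pW R n₁) := by
  rw [reach_spine R n₁ hA hL]
  have h := hA.rootStep_le_lastStep
  have h' := hA.lastStep_le
  omega

end Spine

/-! ## §4 Sanity, decided: the COUNT road's sanity history `hist` -/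

section Sanity

open PGen.Sanity

/-- the sizes of the sanity run: `R ≡ 2`, `n₁ = 3` [folklore] -/
def R₂ : ℕ → ℕ := fun _ => 2

/-- the fat waiting time of a class-`2` region is `1` [folklore] -/
theorem fatWait_two : fatWait 2 = 1 := by
  have h : Nat.log 2 2 = 1 := Nat.log_eq_one_iff'.2 ⟨le_rfl, by norm_num⟩
  simp [fatWait, h]

/-- the fat waiting time of a class-`1` region is `1` [folklore] -/
theorem fatWait_one : fatWait 1 = 1 := by
  simp [fatWait]

/-- the spine of `hist = renew (join (birth 0 1 5) (birth 2 2 9) 3) 6`: root `(0, 1, 5)`, then the absorption at step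
`3` of the class-`2` region born at `2` (its reach `2 + (1 + 2 + 1) = 6`, remaining life `3`), then the renewal at
`7` [folklore] -/
example : spine R₂ 3 hist =
    ⟨PLabel.root 0 1 5, [],
      [⟨3, Move.renew (PLabel.ren 7), []⟩,
       ⟨2, Move.absorb (PLabel.dummy (PGen.birth 2 2 9) 3) (PLabel.join 3), []⟩]⟩ := by
  simp [hist, spine, addMove, Rec.last, endAge, PGen.rootStep, PGen.toGen, R₂, dictW, fatWait_two, PEv.kind, PEv.fat]

/-- `hist` is booked alive for the sanity windows, and its spine is valid, reaches the canonical `7 + 1 + 3 = 11`, and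
has age `7 = lastStep − rootStep` [folklore] -/
example : hist.Alive (dictW R₂ 3) ∧ (spine R₂ 3 hist).Valid (pW R₂ 3) 0 ∧
    ((spine R₂ 3 hist).tree 0).reach (pW R₂ 3) = hist.toGen.reach (dictW R₂ 3) ∧
    hist.toGen.reach (dictW R₂ 3) = 10 ∧ (spine R₂ 3 hist).last = 7 := by
  have hA : hist.Adm 7 := hist_adm
  have hL : hist.Alive (dictW R₂ 3) := by
    refine ⟨⟨trivial, trivial, ?_, ?_⟩, ?_⟩ <;>
      simp [PGen.toGen, R₂, dictW, fatWait_two, fatWait_one, PEv.kind, PEv.fat]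
  refine ⟨hL, valid_spine R₂ 3 hA hL, reach_spine R₂ 3 hA hL, ?_, ?_⟩
  · simp [hist, PGen.toGen, R₂, dictW, PEv.kind]
  · have h := last_spine R₂ 3 hA
    simpa [hist, PGen.rootStep, PGen.lastStep] using h

end Sanity

end Summit.QuantumFields.BalabanUV.T4Continuum.RenewalSpine
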